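/-
Copyright (c) 2026. All rights reserved.
Released under Apache 2.0 license as described in the file LICENSE.
Authors: abc-iut cell, wave-3 discharge seat abc-iut-L6-d2 (gen 4) ([AbsTopIII] Prop 5.8 (i)–(iii) /
[IUTchIII] Prop 1.2 (vi) at the model, CLOSED FORM: the inhabited algorithm evaluated at `G = G_E` itself).
-/
import Literature.AnabelianGeometry.AbsoluteAnabelian.MonoAnalyticNonarchAlgorithmModel
import Literature.AnabelianGeometry.AbsoluteAnabelian.MLFGaloisTypeProofs
import HarnessLib

/-!
# [AbsTopIII] Prop 5.8 (i)–(iii) at `G = G_E`: the algorithm's output in closed form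

S. Mochizuki, *Topics in absolute anabelian geometry III*, J. Math. Sci. Univ. Tokyo 22 (2015)
[MochizukiAbsTopIII2015], Prop 5.8 (i)–(iii) pp. 139–140 (kurims manuscript, lit key
`paper:url-5493eb38cbb7`); consumed by [IUTchIII] Prop 1.2 (vi) (kurims p. 32: "`log(†D⊢_v) := {†G_v ↷
k~(†G_v)}`, `I_{†D⊢_v} := I(†G_v)`", "compatible with [...] the respective log-shells, and the respective
log-volumes").

`MonoAnalyticNonarchAlgorithmModel.lean` (this seat) inhabits abc-iut-L4-t3's `MonoAnalyticNonarchAlgorithm`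
by `model` and proves `model_out_inv_eq` / `model_realLogVol_logShell` for EVERY presentation
`P : G ⥲ G_E`; `MLFGaloisTypeProofs.lean` (this seat) proves `G_E ∈ Ob(TG⊢)`
(`isMLFGaloisType_absoluteGaloisGrp`).  This proof-only file evaluates the algorithm at `G = G_E` ITSELF
through the tautological presentation `G_E ⥲ G_E` — the form in which [IUTchIII] Prop 1.2 (vi) uses it at
`†G_v = G_{K_v}`, `K_v ⊆ ℚ̄_{p_v}`:

* `model_out_inv_absoluteGaloisGrp` — the reconstructed `(p, f, e, m)` at `G_E` are those OF `E`
  (whatever presentation the algorithm chose internally);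
* `model_realLogVol_logShell_absoluteGaloisGrp` — **`μ^log(G_E)(I(G_E)) = μ^log_E(ℐ_E)`**: the mono-analytic
  log-volume of the mono-analytic log-shell, reconstructed from the GROUP `G_E` alone, equals abc-iut-L4-t3's
  Haar log-volume of the holomorphic log-shell `ℐ_E = (p*)⁻¹·log_p(𝒪_E^×)` at the real logarithm
  (`logShell (PadicLogOnUnits.ofUnitLog p E)` = [IUTchIII] Def 1.1 (i)'s `ℐ` by
  `nonarchLogShell_eq_logShell_ofUnitLog`); `…_eq_logShellLogVolume` — the printed value
  `{−1 − m/f + e·log p*/log p}·(f·log p) = e·f·log p* − (f+m)·log p`.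

No hypothesis is left except the data `E`.  HONEST FRAMING: classical; refereed pre-IUT anabelian geometry;
nothing here bears on [IUTchIII] Cor. 3.12; typed ≠ discharged elsewhere.  Proof-only: no definitions.
-/

set_option autoImplicit false

noncomputable section

namespace Literature.AnabelianGeometry.AbsoluteAnabelian

open scoped Literature.IUT.LogVolume

namespace MonoAnalyticNonarchAlgorithm

variable {p : ℕ} [Fact p.Prime] (E : IntermediateField ℚ_[p] (PadicAlgCl p)) [FiniteDimensional ℚ_[p] E]

/-- **Prop 5.8 (i) at `G = G_E`**: the invariants reconstructed by the algorithm `model` at the absolute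
Galois group of a finite `E ⊆ ℚ̄_p` are `(p, f_E, e_E, m_E)` — for ANY proof `hG : G_E ∈ Ob(TG⊢)` (the
tautological presentation `G_E ⥲ G_E` fed to `model_out_inv_eq`). [cite: MochizukiAbsTopIII2015, Prop 5.8 (i) p. 139] -/
theorem model_out_inv_absoluteGaloisGrp (hG : IsMLFGaloisType (absoluteGaloisGrp E)) :
    (model.out (absoluteGaloisGrp E) hG).inv = MLFType.ofPadicSubfield E :=
  model_out_inv_eq (absoluteGaloisGrp E) hG { p := p, E := E, iso := ContinuousMulEquiv.refl _ }

/-- The same with the canonical witness `isMLFGaloisType_absoluteGaloisGrp E` of `G_E ∈ Ob(TG⊢)` — no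
hypothesis left. [cite: MochizukiAbsTopIII2015, Prop 5.8 (i) p. 139] -/
theorem model_out_inv_absoluteGaloisGrp' :
    (model.out (absoluteGaloisGrp E) (isMLFGaloisType_absoluteGaloisGrp E)).inv = MLFType.ofPadicSubfield E :=
  model_out_inv_absoluteGaloisGrp E _

/-- **Prop 5.8 (iii) / [IUTchIII] Prop 1.2 (vi) at `G = G_E`: `μ^log(G_E)(I(G_E)) = μ^log_E(ℐ_E)`** — the
mono-analytic log-volume of the mono-analytic log-shell reconstructed from the group `G_E` ALONE equals
abc-iut-L4-t3's Haar log-volume of the holomorphic log-shell `ℐ_E = (p*)⁻¹·log_p(𝒪_E^×)` at the real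
logarithm ("compatible with [...] the respective log-shells, and the respective log-volumes").
[cite: MochizukiAbsTopIII2015, Prop 5.8 (iii) p. 140] -/
theorem model_realLogVol_logShell_absoluteGaloisGrp [MeasurableSpace E] [BorelSpace E]
    (hG : IsMLFGaloisType (absoluteGaloisGrp E)) :
    (model.out (absoluteGaloisGrp E) hG).realLogVol (model.out (absoluteGaloisGrp E) hG).logShell =
      localLogVolume E (AbsoluteAnabelian.logShell (PadicLogOnUnits.ofUnitLog p E)) :=
  model_realLogVol_logShell (absoluteGaloisGrp E) hG { p := p, E := E, iso := ContinuousMulEquiv.refl _ }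

/-- … and that common value is the printed one, `{−1 − m_E/f_E + e_E·log p*/log p}·(f_E·log p)
= e_E·f_E·log p* − (f_E + m_E)·log p` (`MLFType.logShellLogVolume`). [cite: MochizukiAbsTopIII2015, Prop 5.8 (iii) p. 140] -/
theorem model_realLogVol_logShell_absoluteGaloisGrp_eq_logShellLogVolume
    (hG : IsMLFGaloisType (absoluteGaloisGrp E)) :
    (model.out (absoluteGaloisGrp E) hG).realLogVol (model.out (absoluteGaloisGrp E) hG).logShell =
      (MLFType.ofPadicSubfield E).logShellLogVolume := by
  rw [MonoAnalyticNonarch.realLogVol_logShell, model_out_inv_absoluteGaloisGrp]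

end MonoAnalyticNonarchAlgorithm

end Literature.AnabelianGeometry.AbsoluteAnabelian

end
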